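import Summits.QuantumFields.QCD.Theses.HeatSlicedQuarks

/-!
# `QuarkLoopCoefficient` — negative-side support: load-bearing hypotheses, a genuine flux inhabitant,
# coefficient rigidity

Support file for crux `stmt-QuantumFields-16786` (`HeatSlicedQuarks.QuarkLoopCoefficient`, rank 7), extracted from the
standing disprover's work file `Cruxes/QuarkLoopCoefficient/Disproof.lean` (cdisprove cycle 1, 2026-08-17).  Tree objects
only (`wilsonDirac`, `plaquetteHolonomy`, `fundamentalRep`, Mathlib's `ZMod.toCircle`); nothing is posited, no `sorry`.

* §0 `QLCWith κ`: the crux with a general main-term coefficient `κ·(1 − cos θ)` (verbatim otherwise);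
  `quarkLoopCoefficient_iff : QuarkLoopCoefficient ↔ QLCWith (1/(3π²))`.
* §1 `fluxConfig L`: a GENUINE inhabitant of the three structural hypotheses for every `L` — Cartan links
  `U(y,1) = diag(ω^{y₀}, ω^{−y₀}, 1)`, `ω = e^{2πi/L}` (flux quantum `k = L`, so no wrap row is needed), all other links `1`:
  `fluxConfig_cartan`, `fluxConfig_flux` (constant `(0,1)` plaquette `diag(e^{iθ_L}, e^{−iθ_L}, 1)`, `θ_L = 2π/L`),
  `fluxConfig_flat`.  With `L = s²`, `θ = 2π/s²`, `t = s`, `s ≥ 7`, the point is inside the crux window (`window_seq`), so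
  the hypotheses are met by NON-FLAT fields at every large volume (the torons of the 17986 refutation have `θ = 0`).
* `envelope_small`: along that sequence the crux envelope `Cθ²(1/t + θ²t²) + Ce^{−cL²/(t+L)}/t²` is `o(θ²)`.
* §2 `quarkLoopCoefficient_false_without_flux`: with the flux hypothesis dropped, `θ` decouples from `U` and the trivial
  field refutes the statement — the main term is not absorbable in the envelope; any proof must use the flux hypothesis.
* §3 `qlcWith_unique : QLCWith κ → QLCWith κ' → κ = κ'` and
  `quarkLoopCoefficient_pins_coefficient : QuarkLoopCoefficient → κ ≠ 1/(3π²) → ¬ QLCWith κ`: the crux shape admits at most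
  ONE coefficient, so the route's kill criterion K1 (a measured lattice plateau `≠ 1/(3π²)`) refutes the crux as typed.
* (§4, the cap `t ≤ L²`, is in the sibling file `Negative/TimeCap.lean`.)

All conclusions are negations / equations / inequalities; no Theses decl is asserted positively.
-/

noncomputable section

namespace Summit.QuantumFields.QCD.Theorems.QuarkLoopCoefficient.Negative

open Literature.MathematicalPhysics.QuantumLattice Literature.MathematicalPhysics.QuantumFieldTheory
open Literature.Probability.LatticeModels (Site TorusSite)
open Summit.QuantumFields.QCD.Theses.HeatSlicedQuarks
open scoped Matrix ComplexConjugate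

/-- `SU(3)`. -/
abbrev SU3 : Type := Matrix.specialUnitaryGroup (Fin 3) ℂ

/-! ### §0 The crux with a general coefficient -/

/-- The crux `QuarkLoopCoefficient` with the main term `(1 − cos θ)/(3π²)` replaced by `κ·(1 − cos θ)`
(verbatim otherwise). -/
def QLCWith (κ : ℝ) : Prop :=
  ∃ C c : ℝ, 0 < c ∧ ∀ (L : ℕ) [NeZero L] (U : Literature.MathematicalPhysics.QuantumFieldTheory.GaugeConfig 4 L (Matrix.specialUnitaryGroup (Fin 3) ℂ)) (θ : ℝ), (∀ (e : Literature.MathematicalPhysics.QuantumFieldTheory.Edge 4 L) (i j : Fin 3), i ≠ j → (Literature.MathematicalPhysics.QuantumLattice.fundamentalRep (Fin 3)) (U e) i j = 0) → (∀ y : Literature.Probability.LatticeModels.TorusSite 4 L, (Literature.MathematicalPhysics.QuantumLattice.fundamentalRep (Fin 3)) (Literature.MathematicalPhysics.QuantumFieldTheory.plaquetteHolonomy U y 0 1) = Matrix.diagonal ![Complex.exp (Complex.I * θ), Complex.exp (-(Complex.I * θ)), 1]) → (∀ (y : Literature.Probability.LatticeModels.TorusSite 4 L) (μ ν : Fin 4),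 ¬(μ = 0 ∧ ν = 1) → ¬(μ = 1 ∧ ν = 0) → Literature.MathematicalPhysics.QuantumFieldTheory.plaquetteHolonomy U y μ ν = 1) → ∀ (t : ℝ), 1 ≤ t → t ≤ (L : ℝ) ^ 2 → t * |θ| ≤ 1 → ∀ (x : Literature.Probability.LatticeModels.TorusSite 4 L), |(∑ a : Fin 3, ∑ α : Fin 4, ((NormedSpace.exp (-(t : ℂ) • (Matrix.conjTranspose (Literature.MathematicalPhysics.QuantumLattice.wilsonDirac (Literature.MathematicalPhysics.QuantumLattice.fundamentalRep (Fin 3)) U 0 1) * Literature.MathematicalPhysics.QuantumLattice.wilsonDirac (Literature.MathematicalPhysics.QuantumLattice.fundamentalRep (Fin 3)) U 0 1))) (x, a, α) (x, a, α)).re) - (∑ a : Fin 3, ∑ α : Fin 4, ((NormedSpace.exp (-(t : ℂ) • (Matrix.conjTranspose (Literature.MathematicalPhysics.QuantumLattice.wilsonDirac (Literature.MathematicalPhysics.QuantumLattice.fundamentalRep (Fin 3)) (fun _ : Literature.MathematicalPhysics.QuantumFieldTheory.Edge 4 L => (1 : Matrix.specialUnitaryGroup (Fin 3) ℂ)) 0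 1) * Literature.MathematicalPhysics.QuantumLattice.wilsonDirac (Literature.MathematicalPhysics.QuantumLattice.fundamentalRep (Fin 3)) (fun _ : Literature.MathematicalPhysics.QuantumFieldTheory.Edge 4 L => (1 : Matrix.specialUnitaryGroup (Fin 3) ℂ)) 0 1))) (x, a, α) (x, a, α)).re) - κ * (1 - Real.cos θ)| ≤ C * θ ^ 2 * (1 / t + θ ^ 2 * t ^ 2) + C * Real.exp (-(c * (L : ℝ) ^ 2 / (t + (L : ℝ)))) / t ^ 2

/-- The crux is the case `κ = 1/(3π²)`. -/
theorem quarkLoopCoefficient_iff : QuarkLoopCoefficient ↔ QLCWith (1 / (3 * Real.pi ^ 2)) := by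
  unfold QuarkLoopCoefficient QLCWith
  simp only [one_div_mul_eq_div]

/-! ### §1 A genuine flux configuration for every `L` -/

/-- The Cartan phase vector `(z, z̄, 1)`. -/
def cartanVec (z : Circle) : Fin 3 → ℂ := ![(z : ℂ), ((z⁻¹ : Circle) : ℂ), 1]

/-- `diag(z, z̄, 1)` is special unitary for `z` on the unit circle. [folklore] -/
theorem cartan_mem (z : Circle) : Matrix.diagonal (cartanVec z) ∈ Matrix.specialUnitaryGroup (Fin 3) ℂ := by
  rw [Matrix.mem_specialUnitaryGroup_iff, Matrix.mem_unitaryGroup_iff]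
  constructor
  · rw [Matrix.star_eq_conjTranspose, Matrix.diagonal_conjTranspose, Matrix.diagonal_mul_diagonal,
      ← Matrix.diagonal_one]
    congr 1
    funext i
    fin_cases i
    · simp [cartanVec, ← Circle.coe_inv_eq_conj]
    · simp [cartanVec, ← Circle.coe_inv_eq_conj]
    · simp [cartanVec]
  · rw [Matrix.det_diagonal, Fin.prod_univ_three]
    simp [cartanVec]

/-- `diag(z, z̄, 1) ∈ SU(3)`. -/
def cartan (z : Circle) : SU3 := ⟨Matrix.diagonal (cartanVec z), cartan_mem z⟩

/-- Underlying matrix of `cartan z`. [folklore] -/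
@[simp] theorem coe_cartan (z : Circle) : ((cartan z : SU3) : Matrix (Fin 3) (Fin 3) ℂ) = Matrix.diagonal (cartanVec z) :=
  rfl

/-- `cartan` is multiplicative. [folklore] -/
theorem cartan_mul (z w : Circle) : cartan (z * w) = cartan z * cartan w := by
  apply Subtype.ext
  change Matrix.diagonal (cartanVec (z * w)) = Matrix.diagonal (cartanVec z) * Matrix.diagonal (cartanVec w)
  rw [Matrix.diagonal_mul_diagonal]
  congr 1
  funext i
  fin_cases i
  · simp [cartanVec]
  · simp [cartanVec, mul_comm]
  · simp [cartanVec]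

/-- The Cartan phases commute. [folklore] -/
theorem cartan_comm (z w : Circle) : cartan z * cartan w = cartan w * cartan z := by
  rw [← cartan_mul, ← cartan_mul, mul_comm]

/-- The link phase `a ↦ diag(ω^a, ω^{-a}, 1)`, `ω = e^{2πi/L}`, additive in `a : ZMod L`. -/
def linkPhase (L : ℕ) [NeZero L] (a : ZMod L) : SU3 := cartan (ZMod.toCircle a)

/-- `linkPhase` is an additive-to-multiplicative character of `ZMod L`. [folklore] -/
theorem linkPhase_add (L : ℕ) [NeZero L] (a b : ZMod L) :
    linkPhase L (a + b) = linkPhase L a * linkPhase L b := by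
  unfold linkPhase
  rw [AddChar.map_add_eq_mul, cartan_mul]

/-- **The flux configuration**: `U(y,1) = diag(ω^{y₀}, ω^{−y₀}, 1)`, all other links trivial. -/
def fluxConfig (L : ℕ) [NeZero L] : GaugeConfig 4 L SU3 :=
  fun e => if e.2 = 1 then linkPhase L (e.1 0) else 1

/-- The flux configuration is Cartan-diagonal (crux hypothesis H₁). [folklore] -/
theorem fluxConfig_cartan (L : ℕ) [NeZero L] (e : Edge 4 L) (i j : Fin 3) (h : i ≠ j) :
    (fundamentalRep (Fin 3)) (fluxConfig L e) i j = 0 := by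
  unfold fluxConfig
  split_ifs
  · simp [linkPhase, Matrix.diagonal_apply_ne _ h]
  · simp [Matrix.one_apply_ne h]

/-- Coordinates of the shifted site `x + e_μ`. [folklore] -/
theorem shift_apply (L : ℕ) (y : TorusSite 4 L) (μ ν : Fin 4) :
    (Literature.MathematicalPhysics.QuantumFieldTheory.Site.shift y μ) ν = y ν + if ν = μ then 1 else 0 := by
  simp [Literature.MathematicalPhysics.QuantumFieldTheory.Site.shift, Pi.single_apply]

/-- The `(0,1)` plaquette of the flux configuration is the constant `linkPhase L 1`. [folklore] -/
theorem fluxConfig_plaq01 (L : ℕ) [NeZero L] (y : TorusSite 4 L) :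
    plaquetteHolonomy (fluxConfig L) y 0 1 = linkPhase L 1 := by
  simp only [plaquetteHolonomy, fluxConfig, shift_apply, if_true, zero_ne_one, if_false, inv_one, mul_one,
    one_mul, add_zero]
  rw [add_comm, linkPhase_add, mul_inv_cancel_right]

/-- Crux hypothesis H₂ for the flux configuration with `θ = 2π/L`: constant plaquette `diag(e^{iθ}, e^{−iθ}, 1)` in the `(0,1)` plane. [folklore] -/
theorem fluxConfig_flux (L : ℕ) [NeZero L] (y : TorusSite 4 L) :
    (fundamentalRep (Fin 3)) (plaquetteHolonomy (fluxConfig L) y 0 1) =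
      Matrix.diagonal ![Complex.exp (Complex.I * ((2 * Real.pi / (L : ℝ) : ℝ) : ℂ)),
        Complex.exp (-(Complex.I * ((2 * Real.pi / (L : ℝ) : ℝ) : ℂ))), 1] := by
  rw [fluxConfig_plaq01]
  have h1 : ((ZMod.toCircle (1 : ZMod L) : Circle) : ℂ) = Complex.exp (Complex.I * ((2 * Real.pi / (L : ℝ) : ℝ) : ℂ)) := by
    have := ZMod.toCircle_natCast (N := L) 1
    rw [Nat.cast_one] at this
    rw [this]
    congr 1
    push_cast
    ring
  simp only [linkPhase, fundamentalRep_apply, coe_cartan, cartanVec]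
  congr 1
  funext i
  fin_cases i
  · simpa using h1
  · simp only [Circle.coe_inv, h1, ← Complex.exp_neg]
  · simp

/-- Crux hypothesis H₃ for the flux configuration: every plaquette outside the `(0,1)`/`(1,0)` plane is trivial. [folklore] -/
theorem fluxConfig_flat (L : ℕ) [NeZero L] (y : TorusSite 4 L) (μ ν : Fin 4)
    (h01 : ¬(μ = 0 ∧ ν = 1)) (h10 : ¬(μ = 1 ∧ ν = 0)) :
    plaquetteHolonomy (fluxConfig L) y μ ν = 1 := by
  fin_cases μ <;> fin_cases ν <;>
    simp_all [plaquetteHolonomy, fluxConfig, shift_apply]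


/-- The trivial field is Cartan-diagonal. [folklore] -/
theorem fluxConfig_one_apply (L : ℕ) [NeZero L] (e : Edge 4 L) (i j : Fin 3) (h : i ≠ j) :
    (fundamentalRep (Fin 3)) ((fun _ : Edge 4 L => (1 : SU3)) e) i j = 0 := by
  simp [Matrix.one_apply_ne h]

/-- The trivial field is flat. [folklore] -/
theorem plaquette_one (L : ℕ) (y : TorusSite 4 L) (μ ν : Fin 4) :
    plaquetteHolonomy (fun _ : Edge 4 L => (1 : SU3)) y μ ν = 1 := by
  simp [plaquetteHolonomy]

/-! ### Analytic bookkeeping along the sequence `L = s²`, `θ = 2π/s²`, `t = s` -/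

/-- `1 − cos θ ≥ (43/96) θ²` on `|θ| ≤ 1` (from `Real.cos_bound`). -/
theorem one_sub_cos_ge {θ : ℝ} (h : |θ| ≤ 1) : 43 / 96 * θ ^ 2 ≤ 1 - Real.cos θ := by
  have hb := (abs_le.mp (Real.cos_bound h)).2
  have h0 : 0 ≤ |θ| := abs_nonneg θ
  have hsq : θ ^ 2 = |θ| ^ 2 := (sq_abs θ).symm
  have h4 : |θ| ^ 4 ≤ θ ^ 2 := by
    rw [hsq]
    have h2 : |θ| ^ 2 ≤ 1 := by nlinarith
    calc |θ| ^ 4 = |θ| ^ 2 * |θ| ^ 2 := by ring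
      _ ≤ |θ| ^ 2 * 1 := by gcongr
      _ = |θ| ^ 2 := by ring
  nlinarith

/-- The two sides of the crux inequality along the sequence, as functions of `s`. -/
def env (C c : ℝ) (s : ℕ) : ℝ :=
  C * (2 * Real.pi / (s : ℝ) ^ 2) ^ 2 * (1 / (s : ℝ) + (2 * Real.pi / (s : ℝ) ^ 2) ^ 2 * (s : ℝ) ^ 2) +
    C * Real.exp (-(c * ((s : ℝ) ^ 2) ^ 2 / ((s : ℝ) + (s : ℝ) ^ 2))) / (s : ℝ) ^ 2

/-- KEY ESTIMATE: along `L = s²`, `θ = 2π/s²`, `t = s` the envelope `Cθ²(1/t + θ²t²) + Ce^{−cL²/(t+L)}/t²` is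
`o(θ²)`: eventually `< δ θ²` for every `δ > 0`. -/
theorem envelope_small (C c δ : ℝ) (hc : 0 < c) (hδ : 0 < δ) :
    ∃ s₀ : ℕ, 7 ≤ s₀ ∧ ∀ s : ℕ, s₀ ≤ s → env C c s < δ * (2 * Real.pi / (s : ℝ) ^ 2) ^ 2 := by
  set M : ℝ := |C| * (1 + 4 * Real.pi ^ 2 + 8 / (Real.pi ^ 2 * c ^ 2)) + 1 with hM
  have hMpos : 0 < M := by positivity
  obtain ⟨s₀, hs₀⟩ := exists_nat_gt (max 7 (M / δ))
  have hs₀7 : (7 : ℝ) < s₀ := lt_of_le_of_lt (le_max_left _ _) hs₀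
  refine ⟨s₀, by exact_mod_cast hs₀7.le, fun s hs => ?_⟩
  have hcast : (s₀ : ℝ) ≤ s := by exact_mod_cast hs
  have hS7 : (7 : ℝ) < s := lt_of_lt_of_le hs₀7 hcast
  have hSM : M / δ < s := lt_of_lt_of_le (lt_of_le_of_lt (le_max_right _ _) hs₀) hcast
  have hS1 : (1 : ℝ) ≤ s := by linarith
  have hS0 : (0 : ℝ) < s := by linarith
  have hπ := Real.pi_gt_three
  -- abbreviations
  have hθ2val : (2 * Real.pi / (s : ℝ) ^ 2) ^ 2 = 4 * Real.pi ^ 2 / (s : ℝ) ^ 4 := by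
    field_simp; ring
  have hθ2pos : 0 < (2 * Real.pi / (s : ℝ) ^ 2) ^ 2 := by positivity
  -- term 1
  have h1 : C * (2 * Real.pi / (s : ℝ) ^ 2) ^ 2 * (1 / (s : ℝ) + (2 * Real.pi / (s : ℝ) ^ 2) ^ 2 * (s : ℝ) ^ 2) ≤
      |C| * (2 * Real.pi / (s : ℝ) ^ 2) ^ 2 * ((1 + 4 * Real.pi ^ 2) / (s : ℝ)) := by
    have hle : 1 / (s : ℝ) + (2 * Real.pi / (s : ℝ) ^ 2) ^ 2 * (s : ℝ) ^ 2 ≤ (1 + 4 * Real.pi ^ 2) / (s : ℝ) := by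
      have hA : (2 * Real.pi / (s : ℝ) ^ 2) ^ 2 * (s : ℝ) ^ 2 = 4 * Real.pi ^ 2 / (s : ℝ) ^ 2 := by
        field_simp; ring
      have hB : 4 * Real.pi ^ 2 / (s : ℝ) ^ 2 ≤ 4 * Real.pi ^ 2 / (s : ℝ) :=
        div_le_div_of_nonneg_left (by positivity) hS0 (by nlinarith)
      rw [hA, add_div]
      linarith
    have hnn : 0 ≤ (2 * Real.pi / (s : ℝ) ^ 2) ^ 2 * (1 / (s : ℝ) + (2 * Real.pi / (s : ℝ) ^ 2) ^ 2 * (s : ℝ) ^ 2) := by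
      positivity
    calc C * (2 * Real.pi / (s : ℝ) ^ 2) ^ 2 * (1 / (s : ℝ) + (2 * Real.pi / (s : ℝ) ^ 2) ^ 2 * (s : ℝ) ^ 2)
        ≤ |C| * (2 * Real.pi / (s : ℝ) ^ 2) ^ 2 * (1 / (s : ℝ) + (2 * Real.pi / (s : ℝ) ^ 2) ^ 2 * (s : ℝ) ^ 2) := by
          rw [mul_assoc, mul_assoc]
          exact mul_le_mul_of_nonneg_right (le_abs_self C) hnn
      _ ≤ |C| * (2 * Real.pi / (s : ℝ) ^ 2) ^ 2 * ((1 + 4 * Real.pi ^ 2) / (s : ℝ)) := by gcongr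
  -- term 2
  have h2 : C * Real.exp (-(c * ((s : ℝ) ^ 2) ^ 2 / ((s : ℝ) + (s : ℝ) ^ 2))) / (s : ℝ) ^ 2 ≤
      |C| * (2 * Real.pi / (s : ℝ) ^ 2) ^ 2 * ((8 / (Real.pi ^ 2 * c ^ 2)) / (s : ℝ)) := by
    have hexp_arg : c * (s : ℝ) ^ 2 / 2 ≤ c * ((s : ℝ) ^ 2) ^ 2 / ((s : ℝ) + (s : ℝ) ^ 2) := by
      rw [div_le_div_iff₀ (by norm_num) (by positivity)]
      have h' : (s : ℝ) + (s : ℝ) ^ 2 ≤ 2 * (s : ℝ) ^ 2 := by nlinarith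
      have hc0 : 0 ≤ c * (s : ℝ) ^ 2 := by positivity
      nlinarith [mul_le_mul_of_nonneg_left h' hc0]
    have hE : Real.exp (-(c * ((s : ℝ) ^ 2) ^ 2 / ((s : ℝ) + (s : ℝ) ^ 2))) ≤ 2 / (c * (s : ℝ) ^ 2 / 2) ^ 2 :=
      (Real.exp_le_exp.mpr (neg_le_neg hexp_arg)).trans (by
        -- `e^{−x} ≤ 2/x²` for `x > 0`, from `1 + x + x²/2 ≤ eˣ`
        have hx : 0 < c * (s : ℝ) ^ 2 / 2 := by positivity
        have hq := Real.quadratic_le_exp_of_nonneg hx.le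
        rw [Real.exp_neg, inv_eq_one_div, div_le_div_iff₀ (Real.exp_pos _) (by positivity)]
        nlinarith)
    have hE2 : 2 / (c * (s : ℝ) ^ 2 / 2) ^ 2 = (2 * Real.pi / (s : ℝ) ^ 2) ^ 2 * (2 / (Real.pi ^ 2 * c ^ 2)) := by
      rw [hθ2val]; field_simp; ring
    have hS2 : 1 / (s : ℝ) ^ 2 ≤ 1 / (s : ℝ) := div_le_div_of_nonneg_left zero_le_one hS0 (by nlinarith)
    calc C * Real.exp (-(c * ((s : ℝ) ^ 2) ^ 2 / ((s : ℝ) + (s : ℝ) ^ 2))) / (s : ℝ) ^ 2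
        ≤ |C| * Real.exp (-(c * ((s : ℝ) ^ 2) ^ 2 / ((s : ℝ) + (s : ℝ) ^ 2))) / (s : ℝ) ^ 2 := by
          gcongr; exact le_abs_self C
      _ ≤ |C| * ((2 * Real.pi / (s : ℝ) ^ 2) ^ 2 * (2 / (Real.pi ^ 2 * c ^ 2))) / (s : ℝ) ^ 2 := by
          rw [← hE2]; gcongr
      _ = (|C| * (2 * Real.pi / (s : ℝ) ^ 2) ^ 2 * (2 / (Real.pi ^ 2 * c ^ 2))) * (1 / (s : ℝ) ^ 2) := by ring
      _ ≤ (|C| * (2 * Real.pi / (s : ℝ) ^ 2) ^ 2 * (8 / (Real.pi ^ 2 * c ^ 2))) * (1 / (s : ℝ)) := by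
          apply mul_le_mul _ hS2 (by positivity) (by positivity)
          gcongr; norm_num
      _ = |C| * (2 * Real.pi / (s : ℝ) ^ 2) ^ 2 * ((8 / (Real.pi ^ 2 * c ^ 2)) / (s : ℝ)) := by ring
  -- combine
  have hsum : env C c s ≤ (2 * Real.pi / (s : ℝ) ^ 2) ^ 2 * ((M - 1) / (s : ℝ)) := by
    have hid : |C| * (2 * Real.pi / (s : ℝ) ^ 2) ^ 2 * ((1 + 4 * Real.pi ^ 2) / (s : ℝ)) +
        |C| * (2 * Real.pi / (s : ℝ) ^ 2) ^ 2 * ((8 / (Real.pi ^ 2 * c ^ 2)) / (s : ℝ)) =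
        (2 * Real.pi / (s : ℝ) ^ 2) ^ 2 * ((M - 1) / (s : ℝ)) := by
      rw [hM]; field_simp; ring
    unfold env
    linarith
  have hrate : (M - 1) / (s : ℝ) < δ := by
    rw [div_lt_iff₀ hS0]
    have h' : M < δ * s := by
      have := (div_lt_iff₀ hδ).mp hSM
      linarith [mul_comm δ (s : ℝ)]
    linarith
  calc env C c s ≤ (2 * Real.pi / (s : ℝ) ^ 2) ^ 2 * ((M - 1) / (s : ℝ)) := hsum
    _ < (2 * Real.pi / (s : ℝ) ^ 2) ^ 2 * δ := by gcongr
    _ = δ * (2 * Real.pi / (s : ℝ) ^ 2) ^ 2 := by ring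

/-- Arithmetic of the window along the sequence: `1 ≤ t`, `t ≤ L²`, `t|θ| ≤ 1` for `s ≥ 7`. -/
theorem window_seq {s : ℕ} (hs : 7 ≤ s) :
    (1 : ℝ) ≤ (s : ℝ) ∧ (s : ℝ) ≤ (((s * s : ℕ) : ℝ)) ^ 2 ∧ (s : ℝ) * |2 * Real.pi / ((s * s : ℕ) : ℝ)| ≤ 1 ∧
      |2 * Real.pi / ((s * s : ℕ) : ℝ)| ≤ 1 := by
  have hS7 : (7 : ℝ) ≤ s := by exact_mod_cast hs
  have hS0 : (0 : ℝ) < s := by linarith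
  have hπ := Real.pi_lt_d2
  have hπ0 := Real.pi_pos
  have hcast : ((s * s : ℕ) : ℝ) = (s : ℝ) * s := by push_cast; ring
  have habs : |2 * Real.pi / ((s * s : ℕ) : ℝ)| = 2 * Real.pi / ((s : ℝ) * s) := by
    rw [hcast]; exact abs_of_pos (by positivity)
  refine ⟨by linarith, ?_, ?_, ?_⟩
  · rw [hcast]
    have h1 : (s : ℝ) ≤ (s : ℝ) * s := by nlinarith
    have h2 : (s : ℝ) * s ≤ ((s : ℝ) * s) ^ 2 := by nlinarith
    linarith
  · rw [habs, mul_div_assoc', div_le_one (by positivity)]; nlinarith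
  · rw [habs, div_le_one (by positivity)]; nlinarith

/-- Triangle-inequality shape used by the rigidity argument. -/
theorem abs_coeff_sub_le {X m κ κ' E E' : ℝ} (h1 : |X - κ * m| ≤ E) (h2 : |X - κ' * m| ≤ E') :
    |κ - κ'| * |m| ≤ E + E' := by
  rw [← abs_mul, sub_mul]
  calc |κ * m - κ' * m| ≤ |κ * m - X| + |X - κ' * m| := abs_sub_le _ _ _
    _ ≤ E + E' := add_le_add (by rwa [abs_sub_comm]) h2

/-! ### §2 The flux hypothesis is load-bearing -/

/-- The crux with the flux hypothesis `∀ y, ρ(U_{01}(y)) = diag(e^{iθ}, e^{−iθ}, 1)` DROPPED (verbatim otherwise):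
`θ` is then decoupled from `U`. -/
def QuarkLoopCoefficientWithoutFlux : Prop :=
  ∃ C c : ℝ, 0 < c ∧ ∀ (L : ℕ) [NeZero L] (U : Literature.MathematicalPhysics.QuantumFieldTheory.GaugeConfig 4 L (Matrix.specialUnitaryGroup (Fin 3) ℂ)) (θ : ℝ), (∀ (e : Literature.MathematicalPhysics.QuantumFieldTheory.Edge 4 L) (i j : Fin 3), i ≠ j → (Literature.MathematicalPhysics.QuantumLattice.fundamentalRep (Fin 3)) (U e) i j = 0) → (∀ (y : Literature.Probability.LatticeModels.TorusSite 4 L) (μ ν : Fin 4), ¬(μ = 0 ∧ ν = 1) → ¬(μ = 1 ∧ ν = 0) → Literature.MathematicalPhysics.QuantumFieldTheory.plaquetteHolonomy U y μ ν = 1) → ∀ (t : ℝ), 1 ≤ t → t ≤ (L : ℝ) ^ 2 → t * |θ| ≤ 1 → ∀ (x : Literature.Probability.LatticeModels.TorusSite 4 L), |(∑ a : Fin 3, ∑ α : Fin 4, ((NormedSpace.exp (-(t : ℂ) • (Matrix.conjTranspose (Literature.MathematicalPhysics.QuantumLattice.wilsonDirac (Literature.MathematicalPhysics.QuantumLattice.fundamentalRep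 (Fin 3)) U 0 1) * Literature.MathematicalPhysics.QuantumLattice.wilsonDirac (Literature.MathematicalPhysics.QuantumLattice.fundamentalRep (Fin 3)) U 0 1))) (x, a, α) (x, a, α)).re) - (∑ a : Fin 3, ∑ α : Fin 4, ((NormedSpace.exp (-(t : ℂ) • (Matrix.conjTranspose (Literature.MathematicalPhysics.QuantumLattice.wilsonDirac (Literature.MathematicalPhysics.QuantumLattice.fundamentalRep (Fin 3)) (fun _ : Literature.MathematicalPhysics.QuantumFieldTheory.Edge 4 L => (1 : Matrix.specialUnitaryGroup (Fin 3) ℂ)) 0 1) * Literature.MathematicalPhysics.QuantumLattice.wilsonDirac (Literature.MathematicalPhysics.QuantumLattice.fundamentalRep (Fin 3)) (fun _ : Literature.MathematicalPhysics.QuantumFieldTheory.Edge 4 L => (1 : Matrix.specialUnitaryGroup (Fin 3) ℂ)) 0 1))) (x, a, α) (x, a, α)).re) - (1 - Real.cos θ) / (3 * Real.pi ^ 2)| ≤ C * θ ^ 2 * (1 / t + θ ^ 2 * t ^ 2) + C * Real.exp (-(c * (L : ℝ) ^ 2 / (t + (L : ℝ)))) / t ^ 2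

/-- **Any proof of the crux must use the flux hypothesis.**  Witness: the trivial field `U ≡ 1` with
`L = s²`, `θ = 2π/s²`, `t = s`, `s → ∞`: both kernel sums coincide, the left side is `(1 − cos θ)/(3π²) ≥ (43/288π²)θ²`
while the envelope is `o(θ²)` (`envelope_small`). -/
theorem quarkLoopCoefficient_false_without_flux : ¬ QuarkLoopCoefficientWithoutFlux := by
  rintro ⟨C, c, hc, h⟩
  have hδ : (0 : ℝ) < 43 / 96 / (3 * Real.pi ^ 2) := by positivity
  obtain ⟨s, hs7, hsmall⟩ := envelope_small C c _ hc hδ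
  have hsm := hsmall s le_rfl
  obtain ⟨h1t, htL, htθ, hθ1⟩ := window_seq hs7
  haveI : NeZero (s * s) := ⟨by positivity⟩
  have key := h (s * s) (fun _ => 1) (2 * Real.pi / ((s * s : ℕ) : ℝ)) (fluxConfig_one_apply (s * s))
    (fun y μ ν _ _ => plaquette_one (s * s) y μ ν) (s : ℝ) h1t htL htθ (fun _ => 0)
  simp only [sub_self, zero_sub, abs_neg] at key
  have hL : ((s * s : ℕ) : ℝ) = (s : ℝ) ^ 2 := by push_cast; ring
  rw [hL] at key hθ1
  have hmain := one_sub_cos_ge hθ1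
  have hle : 43 / 96 / (3 * Real.pi ^ 2) * (2 * Real.pi / (s : ℝ) ^ 2) ^ 2 ≤
      |(1 - Real.cos (2 * Real.pi / (s : ℝ) ^ 2)) / (3 * Real.pi ^ 2)| := by
    rw [abs_of_nonneg (by have := Real.cos_le_one (2 * Real.pi / (s : ℝ) ^ 2); positivity)]
    rw [div_mul_eq_mul_div, div_le_div_iff_of_pos_right (by positivity)]
    exact hmain
  have : env C c s = C * (2 * Real.pi / (s : ℝ) ^ 2) ^ 2 * (1 / (s : ℝ) + (2 * Real.pi / (s : ℝ) ^ 2) ^ 2 * (s : ℝ) ^ 2) +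
      C * Real.exp (-(c * ((s : ℝ) ^ 2) ^ 2 / ((s : ℝ) + (s : ℝ) ^ 2))) / (s : ℝ) ^ 2 := rfl
  linarith

/-! ### §3 Coefficient rigidity -/

/-- **At most one coefficient.**  If the crux shape holds with main term `κ(1 − cos θ)` and with
`κ'(1 − cos θ)` then `κ = κ'`: evaluate both at the genuine flux configuration `fluxConfig (s²)`
(`θ = 2π/s²`, `t = s`, in the window for `s ≥ 7`) and use that the envelope is `o(1 − cos θ)` there. -/
theorem qlcWith_unique {κ κ' : ℝ} (hκ : QLCWith κ) (hκ' : QLCWith κ') : κ = κ' := by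
  by_contra hne
  obtain ⟨C, c, hc, h⟩ := hκ
  obtain ⟨C', c', hc', h'⟩ := hκ'
  have hpos : 0 < |κ - κ'| := abs_pos.mpr (sub_ne_zero.mpr hne)
  have hδ : (0 : ℝ) < 43 / 96 * |κ - κ'| / 2 := by positivity
  obtain ⟨s₀, hs₀7, hsmall⟩ := envelope_small C c _ hc hδ
  obtain ⟨s₀', hs₀7', hsmall'⟩ := envelope_small C' c' _ hc' hδ
  set s : ℕ := max s₀ s₀' with hsdef
  have hs7 : 7 ≤ s := le_trans hs₀7 (le_max_left _ _)
  have hsm := hsmall s (le_max_left _ _)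
  have hsm' := hsmall' s (le_max_right _ _)
  obtain ⟨h1t, htL, htθ, hθ1⟩ := window_seq hs7
  haveI : NeZero (s * s) := ⟨by positivity⟩
  have k1 := h (s * s) (fluxConfig (s * s)) (2 * Real.pi / ((s * s : ℕ) : ℝ)) (fluxConfig_cartan (s * s))
    (fluxConfig_flux (s * s)) (fluxConfig_flat (s * s)) (s : ℝ) h1t htL htθ (fun _ => 0)
  have k2 := h' (s * s) (fluxConfig (s * s)) (2 * Real.pi / ((s * s : ℕ) : ℝ)) (fluxConfig_cartan (s * s))
    (fluxConfig_flux (s * s)) (fluxConfig_flat (s * s)) (s : ℝ) h1t htL htθ (fun _ => 0)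
  have tri := abs_coeff_sub_le k1 k2
  have hL : ((s * s : ℕ) : ℝ) = (s : ℝ) ^ 2 := by push_cast; ring
  rw [hL] at tri hθ1
  have hmain := one_sub_cos_ge hθ1
  have hm0 : 0 ≤ 1 - Real.cos (2 * Real.pi / (s : ℝ) ^ 2) := by
    have := Real.cos_le_one (2 * Real.pi / (s : ℝ) ^ 2); linarith
  rw [abs_of_nonneg hm0] at tri
  have e1 : env C c s = C * (2 * Real.pi / (s : ℝ) ^ 2) ^ 2 * (1 / (s : ℝ) + (2 * Real.pi / (s : ℝ) ^ 2) ^ 2 * (s : ℝ) ^ 2) +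
      C * Real.exp (-(c * ((s : ℝ) ^ 2) ^ 2 / ((s : ℝ) + (s : ℝ) ^ 2))) / (s : ℝ) ^ 2 := rfl
  have e2 : env C' c' s = C' * (2 * Real.pi / (s : ℝ) ^ 2) ^ 2 * (1 / (s : ℝ) + (2 * Real.pi / (s : ℝ) ^ 2) ^ 2 * (s : ℝ) ^ 2) +
      C' * Real.exp (-(c' * ((s : ℝ) ^ 2) ^ 2 / ((s : ℝ) + (s : ℝ) ^ 2))) / (s : ℝ) ^ 2 := rfl
  nlinarith [mul_le_mul_of_nonneg_left hmain hpos.le]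

/-- **The crux pins its coefficient**: given `QuarkLoopCoefficient`, no other main term `κ(1 − cos θ)`,
`κ ≠ 1/(3π²)`, satisfies the same shape — so a measured lattice plateau `κ_latt ≠ 1/(3π²)` (route kill
criterion K1) refutes the crux as typed rather than re-tuning a constant. -/
theorem quarkLoopCoefficient_pins_coefficient (h : QuarkLoopCoefficient) {κ : ℝ} (hκ : κ ≠ 1 / (3 * Real.pi ^ 2)) :
    ¬ QLCWith κ := fun h' =>
  hκ (qlcWith_unique h' (quarkLoopCoefficient_iff.mp h))

end Summit.QuantumFields.QCD.Theorems.QuarkLoopCoefficient.Negative
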